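import Literature.Geometry.Kaehler.ComplexTorusAnalyticIteratedIntersectionProperPoints
import Literature.Geometry.Kaehler.ComplexTorusAnalyticIteratedIntersectionNumberIntegral
import HarnessLib

/-!
# Proper components amid excess components: every irreducible component of the expected dimension of
# an arbitrary iterated intersection `Y ∩ ⋂_j (D_j − τ_j)` is a component of the Fulton cycle, with
# positive multiplicity; refined Bézout for the proper components

Layer `Literature/Geometry/Kaehler`; lane `lit-hodgefound`, seat p07, programme «INTERSECTION NUMBERS ARE
POINT COUNTS», file 19. Let `X = E/Λ` be a compact complex torus, `Y ⊆ X` closed analytic of pure dimension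
`d = r + 1 + k`, `D₀, …, D_{k−1}` closed analytic hypersurfaces, `τ ∈ X^k` ARBITRARY and
`Z(τ) = Y ∩ ⋂_j (D_j − τ_j)`. A **proper component** of `Z(τ)` is an irreducible component of the expected
dimension `r + 1` (Fulton, Def. 7.1: "an irreducible component `Z` of `W = f⁻¹(X)` is a proper component …
if `dim Z = k − d`"; Example 8.2.1 for `r` factors). Files 10 and 18 represent the intersection class
`sign(e)^k · [Y] ∧ [D₀] ∧ ⋯ ∧ [D_{k−1}]` by an effective `(r+1)`-cycle `R` on `Z(τ)` (Fulton, Cor. 12.2 (a) with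
Example 12.2.1 (a): on an abelian variety "the intersection class can be represented by a non-negative
cycle"), whose support contains every proper point of `Z(τ)` (file 18). This file draws the component-level
consequences — the analytic counterpart of Fulton's Prop. 7.1 (a) "`1 ≤ i(Z, X·V; Y)`" for proper
components together with "each irreducible component of `⋂ V_i` appears as a distinguished variety" and
`α_Z ≥ 0` (Cor. 12.2 (a)):

* §1 `exists_isOpen_nonempty_inter_subset_of_isIrreducibleComponent` — an irreducible component `C` of a closed
  analytic `Z ⊆ X` carries a non-empty open region `V` of `X` on which `Z ⊆ C` (the complement of the other,
  finitely many, components); `one_le_mult_of_isIrreducibleComponent_support` — an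
  irreducible component of the support of an effective cycle of `X` is one of its components, with
  multiplicity `≥ 1`;
* §2 **`exists_effectiveCycle_smul_wedge_wedgeFamily_eq_chainCycleClass_forall_one_le_mult`** — THE THEOREM:
  there is an effective `(r+1)`-cycle `R` with `|R| ⊆ Z(τ)`, `class = cl(R)`, such that EVERY PROPER
  COMPONENT `C` of `Z(τ)` is an irreducible component of `|R|` with `R.mult C ≥ 1`;
* §3 refined Bézout amid excess components: for a `2(r+1)`-form `θ` pairing non-negatively with the
  `(r+1)`-dimensional subvarieties, `Σ_{C proper} Re ⟨θ, [C]⟩ ≤ Re ⟨θ, sign(e)^k · [Y] ∧ [D₀] ∧ ⋯⟩`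
  (`sum_re_poincarePairing_setCycleClass_le_of_proper_components`); polarised by a Riemann form `η`
  (`c₁(L) = ofRealForm(−η)`): `Σ_{C proper} (L^{r+1} · C) ≤ (L^{r+1} · Y · D₀ ⋯ D_{k−1})`, a single proper
  component has `(L^{r+1} · C) ≤ (L^{r+1} · Y · D₀ ⋯ D_{k−1})`, and
  **`#{proper components of Z(τ)} ≤ (L^{r+1} · Y · D₀ ⋯ D_{k−1})`**
  (`IsRiemannForm.ncard_properComponent_le_re_poincarePairing`; the integer form with `= m`). File 9 is the
  case of a globally proper `Z(τ)` (all components proper); here excess components are allowed and simply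
  do not enter the count (their contribution is the rest of the effective cycle `R`, Fulton Example 8.4.6
  "`Σ deg Z_i ≤ ∏ deg V_j`" restricted to the proper `Z_i`).

> [Fulton1998, §7.1 Def. 7.1 and Prop. 7.1 (a) (p. 119–120); §8.2 Example 8.2.1 (p. 137); §8.4
> Example 8.4.6 (p. 148); §12.2 Cor. 12.2 (a), the remark following it, and Example 12.2.1 (a)
> (p. 212–213)]; [Chirka1989, §5.4 Thm. (p. 57), §11.5 Def. (p. 130), §16.1 Prop. 1 (p. 206)].

Theorems only; no definitions, no named facts.

## References

* [Fulton1998] W. Fulton, *Intersection Theory*, 2nd ed., Springer 1998, §7.1 Def. 7.1, Prop. 7.1 (a),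
  §8.2 Example 8.2.1, §8.4 Example 8.4.6, §12.2 Cor. 12.2 (a) and Example 12.2.1 (a).
* [Chirka1989] E. M. Chirka, *Complex Analytic Sets*, Kluwer 1989, §5.3 Cor. 2 (p. 55), §5.4 Thm.
  (p. 57), §11.5 Def. (p. 130), §16.1 Prop. 1 (p. 206).
* [deJong1993AmpleLineBundles] J. de Jong (ed.), *Ample line bundles and intersection theory*, in:
  Diophantine Approximation and Abelian Varieties, LNM 1566, Springer 1993, Ch. VII §4 Remarks 4.3 and
  Thm. 4.3.1.
* [Lange2023AbelianVarietiesComplex] H. Lange, *Abelian Varieties over the Complex Numbers*, Springer 2023,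
  §4.6.2 p. 235.
-/

noncomputable section

open scoped Manifold Topology Pointwise
open MeasureTheory Set Function Filter Module
open Literature.LinearAlgebra.Alternating

namespace Literature.Geometry.Kaehler

universe u

/-! ### §1 Two lemmas on irreducible components on a compact complex torus -/

namespace ComplexTorus

variable {ι : Type*} [Fintype ι] [DecidableEq ι] {E : Type u} [NormedAddCommGroup E] [InnerProductSpace ℂ E]
  [FiniteDimensional ℂ E] [MeasurableSpace E] [BorelSpace E] (Φ : (ι → ℝ) ≃L[ℝ] E) {n : ℕ} (e : Fin n ≃ ι)

omit [DecidableEq ι] [MeasurableSpace E] [BorelSpace E] in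
/-- **An irreducible component is, somewhere, the whole set.** For a closed analytic `Z ⊆ X` and an
irreducible component `C` of `Z` there is an open `V ⊆ X` meeting `C` with `Z ∩ V ⊆ C`: the complement of
the union of the other (finitely many, closed) irreducible components — `C` is not covered by them (it would
lie in one of them, contradicting maximality), and every point of `Z` lies on some component.
[cite: Chirka1989, §5.4 Thm., p. 57] -/
theorem exists_isOpen_nonempty_inter_subset_of_isIrreducibleComponent {Z C : Set (ComplexTorus Φ)}
    (hZ : IsAnalyticSet 𝓘(ℂ, E) Z) (hC : IsIrreducibleComponent 𝓘(ℂ, E) Z C) :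
    ∃ V : Set (ComplexTorus Φ), IsOpen V ∧ (C ∩ V).Nonempty ∧ Z ∩ V ⊆ C := by
  classical
  have hfin := finite_isIrreducibleComponent Φ hZ
  set S : Finset (Set (ComplexTorus Φ)) := hfin.toFinset.erase C with hS
  have hSmem : ∀ C', C' ∈ S ↔ C' ≠ C ∧ IsIrreducibleComponent 𝓘(ℂ, E) Z C' := fun C' ↦ by
    simp only [hS, Finset.mem_erase, Set.Finite.mem_toFinset, mem_setOf_eq]
  refine ⟨(⋃ C' ∈ S, C')ᶜ, ?_, ?_, ?_⟩
  · exact (isClosed_biUnion_finset fun C' hC' ↦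
      ((hSmem C').1 hC').2.isIrreducibleAnalyticSet.1.isClosed).isOpen_compl
  · -- `C` is not covered by the other components
    by_contra hcov
    have hsub : C ⊆ ⋃ C' ∈ S, C' := by
      intro x hx
      by_contra hx'
      exact hcov ⟨x, hx, hx'⟩
    obtain ⟨C', hC'S, hCC'⟩ := hC.isIrreducibleAnalyticSet.exists_subset_of_subset_biUnion S
      (A := fun C' ↦ C') (fun C' hC' ↦ ((hSmem C').1 hC').2.isIrreducibleAnalyticSet.1) hsub
    obtain ⟨hne, hC'⟩ := (hSmem C').1 hC'S
    exact hne (hC.eq_of_subset hC'.isIrreducibleAnalyticSet hCC' hC'.subset)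
  · -- a point of `Z` off the other components lies on `C`
    rintro x ⟨hxZ, hxV⟩
    obtain ⟨C', hC', hxC'⟩ := (isIrreducibleAnalyticSet_singleton (I := 𝓘(ℂ, E)) x)
      |>.exists_isIrreducibleComponent_superset hZ (singleton_subset_iff.2 hxZ)
    rw [singleton_subset_iff] at hxC'
    by_contra hxC
    have hC'S : C' ∈ S := (hSmem C').2 ⟨fun h ↦ hxC (h ▸ hxC'), hC'⟩
    exact hxV (mem_biUnion hC'S hxC')

omit [DecidableEq ι] [FiniteDimensional ℂ E] [MeasurableSpace E] [BorelSpace E] in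
/-- **An irreducible component of the support of an analytic cycle of the torus is one of its components**:
`|T| = ⋃_{k_W ≠ 0} W` is a finite union of irreducible analytic sets, so an irreducible component `C ⊆ |T|`
lies in some `W` with `k_W ≠ 0`, and `W = C` by maximality. [cite: Chirka1989, §11.5 Def., p. 130; §5.4 Thm., p. 57] -/
theorem mult_ne_zero_of_isIrreducibleComponent_support {p : ℕ}
    (T : HolomorphicChain 𝓘(ℂ, E) (ComplexTorus Φ) p) {C : Set (ComplexTorus Φ)}
    (hC : IsIrreducibleComponent 𝓘(ℂ, E) T.support C) : T.mult C ≠ 0 := by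
  classical
  have hsub : C ⊆ ⋃ W ∈ T.finite_components_of_compactSpace.toFinset, W := by
    rw [← HolomorphicChain.support_eq_biUnion_toFinset]
    exact hC.subset
  obtain ⟨W, hW, hCW⟩ := hC.isIrreducibleAnalyticSet.exists_subset_of_subset_biUnion _
    (A := fun W ↦ W) (fun W hW ↦ (T.isIrreducibleAnalyticSet_of_mult_ne_zero
      (T.finite_components_of_compactSpace.mem_toFinset.1 hW)).1) hsub
  have hW0 : T.mult W ≠ 0 := T.finite_components_of_compactSpace.mem_toFinset.1 hW
  rwa [← hC.eq_of_subset (T.isIrreducibleAnalyticSet_of_mult_ne_zero hW0) hCW (HolomorphicChain.subset_support hW0)]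

omit [DecidableEq ι] [FiniteDimensional ℂ E] [MeasurableSpace E] [BorelSpace E] in
/-- **An irreducible component of the support of an EFFECTIVE cycle has multiplicity `≥ 1`.**
[cite: Chirka1989, §11.5 Def., p. 130] -/
theorem one_le_mult_of_isIrreducibleComponent_support {p : ℕ}
    (T : HolomorphicChain 𝓘(ℂ, E) (ComplexTorus Φ) p) (hT : ∀ W, 0 ≤ T.mult W) {C : Set (ComplexTorus Φ)}
    (hC : IsIrreducibleComponent 𝓘(ℂ, E) T.support C) : 1 ≤ T.mult C := by
  have h := mult_ne_zero_of_isIrreducibleComponent_support Φ T hC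
  have h0 := hT C
  omega

omit [DecidableEq ι] [MeasurableSpace E] [BorelSpace E] in
/-- **An irreducible closed analytic `C ⊆ |T|` of the dimension of the cycle is a component of `T`**, with
multiplicity `≥ 1` if `T` is effective (`|T|` has pure dimension `p` or is empty).
[cite: Chirka1989, §11.5 Def., p. 130; §5.3 Cor. 1, p. 55] -/
theorem isIrreducibleComponent_support_and_one_le_mult_of_subset {p : ℕ}
    (T : HolomorphicChain 𝓘(ℂ, E) (ComplexTorus Φ) p) (hT : ∀ W, 0 ≤ T.mult W)
    (hTs : T.support = ∅ ∨ HasPureDim 𝓘(ℂ, E) T.support p) {C : Set (ComplexTorus Φ)}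
    (hC : IsIrreducibleAnalyticSet 𝓘(ℂ, E) C) (hCp : HasPureDim 𝓘(ℂ, E) C p) (hCT : C ⊆ T.support) :
    IsIrreducibleComponent 𝓘(ℂ, E) T.support C ∧ 1 ≤ T.mult C := by
  have hTp : HasPureDim 𝓘(ℂ, E) T.support p := by
    refine hTs.resolve_left fun h0 ↦ ?_
    obtain ⟨x, hx⟩ := hC.2.1
    have := hCT hx
    rw [h0] at this
    exact this
  have hcomp := isIrreducibleComponent_of_subset_of_hasPureDim hTp hC hCp hCT
  exact ⟨hcomp, one_le_mult_of_isIrreducibleComponent_support Φ T hT hcomp⟩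

/-! ### §2 Proper components lie on the Fulton cycle with positive multiplicity -/

omit [DecidableEq ι] [FiniteDimensional ℂ E] [MeasurableSpace E] [BorelSpace E] in
/-- A finite intersection of closed analytic subsets of the torus is analytic. [cite: Chirka1989, §2.1 item 3] -/
private theorem isAnalyticSet_iInter_fin₁₉ {k : ℕ} {A : Fin k → Set (ComplexTorus Φ)}
    (hA : ∀ j, IsAnalyticSet 𝓘(ℂ, E) (A j)) : IsAnalyticSet 𝓘(ℂ, E) (⋂ j, A j) := by
  classical
  have h : ∀ s : Finset (Fin k), IsAnalyticSet 𝓘(ℂ, E) (⋂ j ∈ s, A j) := by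
    intro s
    induction s using Finset.induction_on with
    | empty => simpa using (isAnalyticSet_univ : IsAnalyticSet 𝓘(ℂ, E) (univ : Set (ComplexTorus Φ)))
    | insert j s hj ih =>
      rw [Finset.set_biInter_insert]
      exact (hA j).inter ih
  simpa using h Finset.univ

omit [DecidableEq ι] [FiniteDimensional ℂ E] [MeasurableSpace E] [BorelSpace E] in
/-- `Z(τ) = Y ∩ ⋂_j (D_j − τ_j)` is a closed analytic subset of the torus. [cite: Chirka1989, §2.1 item 3] -/
theorem isAnalyticSet_inter_iInter_translate {k d q : ℕ} {Y : Set (ComplexTorus Φ)}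
    (hY : HasPureDim 𝓘(ℂ, E) Y d) {D : Fin k → Set (ComplexTorus Φ)} (hD : ∀ j, HasPureDim 𝓘(ℂ, E) (D j) q)
    (τ : Fin k → ComplexTorus Φ) : IsAnalyticSet 𝓘(ℂ, E) (Y ∩ ⋂ j, (fun x ↦ x + τ j) ⁻¹' D j) :=
  hY.isAnalyticSet.inter
    (isAnalyticSet_iInter_fin₁₉ Φ fun j ↦ (hasPureDim_preimage_add_right Φ (hD j) (τ j)).isAnalyticSet)

omit [DecidableEq ι] [MeasurableSpace E] [BorelSpace E] in
/-- On an open `V` where `Z(τ)` coincides with a pure `(r+1)`-dimensional analytic `W`, every point of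
`Z(τ) ∩ V` is proper. [cite: Chirka1989, §12.1, p. 136] -/
private theorem eventually_finrank_le_of_inter_eq_inter₁₉ {k r : ℕ} {Y : Set (ComplexTorus Φ)}
    {D : Fin k → Set (ComplexTorus Φ)} {τ : Fin k → ComplexTorus Φ} {V W : Set (ComplexTorus Φ)}
    (hV : IsOpen V) (hW : HasPureDim 𝓘(ℂ, E) W (r + 1))
    (hZW : (Y ∩ ⋂ j, (fun x ↦ x + τ j) ⁻¹' D j) ∩ V = W ∩ V) {z : ComplexTorus Φ} (hzV : z ∈ V) :
    ∀ᶠ x in 𝓝 z, x ∈ Y ∩ ⋂ j, (fun x ↦ x + τ j) ⁻¹' D j →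
      ∀ q', IsRegularPointOfCodim 𝓘(ℂ, E) (Y ∩ ⋂ j, (fun x ↦ x + τ j) ⁻¹' D j) q' x →
        finrank ℂ E ≤ q' + (r + 1) := by
  obtain ⟨c, hc, -, -, hreg⟩ := hW
  filter_upwards [hV.mem_nhds hzV] with x hxV hxZ q' hq'
  have hxW : x ∈ W := (hZW.subset ⟨hxZ, hxV⟩).1
  have hq'W : IsRegularPointOfCodim 𝓘(ℂ, E) W q' x := hq'.congr_set hV hxV hZW
  have h := (hreg x ⟨hxW, q', hq'W⟩).codim_unique hxW hq'W
  omega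

/-- **PROPER COMPONENTS ARE COMPONENTS OF THE FULTON CYCLE, WITH POSITIVE MULTIPLICITY.** Let `Y ⊆ X` be
closed analytic of pure dimension `d = r + 1 + k`, `D₀, …, D_{k−1}` closed analytic hypersurfaces and
`τ ∈ X^k` arbitrary, `Z(τ) = Y ∩ ⋂_j (D_j − τ_j)`. There is an EFFECTIVE analytic `(r+1)`-cycle `R` with
`|R| ⊆ Z(τ)`, `|R|` empty or of pure dimension `r + 1`, `sign(e)^k · [Y]_e ∧ [D₀]_e ∧ ⋯ ∧ [D_{k−1}]_e = cl(R)`,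
and such that every PROPER COMPONENT `C` of `Z(τ)` — an irreducible component of the expected dimension
`r + 1` — is an irreducible component of `|R|` with `R.mult C ≥ 1`. Indeed off the other components of
`Z(τ)` the set `Z(τ)` coincides with `C` on a non-empty open `V` (§1), so the points of `C ∩ V` are proper
points of `Z(τ)` and lie on `|R|` (file 18); by the uniqueness theorem the irreducible `C` lies in `|R|`,
and an irreducible `(r+1)`-dimensional subset of `|R|` is a component of `R`. This is the analytic form of
Fulton's "`1 ≤ i(Z, V₁ ⋯ V_r; X)`" for proper components `Z` (Prop. 7.1 (a), Example 8.2.1) inside the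
non-negative canonical decomposition on an abelian variety (Cor. 12.2 (a), Example 12.2.1 (a): "each
irreducible component of `⋂ V_i` appears as a distinguished variety").
[cite: Fulton1998, §7.1 Prop. 7.1 (a), §8.2 Example 8.2.1 and §12.2 Cor. 12.2 (a)]
[cite: Chirka1989, §5.3 Cor. 2 (p. 55) and §16.1 Prop. 1 (p. 206)] [cite: Lange2023AbelianVarietiesComplex, §4.6.2 p. 235] -/
theorem exists_effectiveCycle_smul_wedge_wedgeFamily_eq_chainCycleClass_forall_one_le_mult {q : ℕ}
    (hq : 2 * q + 2 * 1 = n) (k : ℕ) {d p p' r : ℕ} (hk : 2 * d + 2 * p = n) (hp' : p + k = p')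
    (hr : r + 1 + k = d) {Y : Set (ComplexTorus Φ)} (hY : HasPureDim 𝓘(ℂ, E) Y d)
    {D : Fin k → Set (ComplexTorus Φ)} (hD : ∀ j, HasPureDim 𝓘(ℂ, E) (D j) q) (τ : Fin k → ComplexTorus Φ) :
    ∃ R : HolomorphicChain 𝓘(ℂ, E) (ComplexTorus Φ) (r + 1), (∀ W, 0 ≤ R.mult W) ∧
      R.support ⊆ Y ∩ ⋂ j, (fun x ↦ x + τ j) ⁻¹' D j ∧
      (R.support = ∅ ∨ HasPureDim 𝓘(ℂ, E) R.support (r + 1)) ∧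
      (∀ C, IsIrreducibleComponent 𝓘(ℂ, E) (Y ∩ ⋂ j, (fun x ↦ x + τ j) ⁻¹' D j) C →
        HasPureDim 𝓘(ℂ, E) C (r + 1) → IsIrreducibleComponent 𝓘(ℂ, E) R.support C ∧ 1 ≤ R.mult C) ∧
        (orientationSign Φ e : ℂ) ^ k •
            ((analyticCycleClass Φ e hk hY).wedge
                (wedgeFamily k fun j ↦ analyticCycleClass Φ e hq (hD j))).domDomCongr
              (finCongr (by omega : 2 * p + 2 * k = 2 * p')) =
          chainCycleClass Φ e (by omega : 2 * (r + 1) + 2 * p' = n) R := by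
  obtain ⟨R, hR0, hRs, hRpure, hmem, hRcl⟩ :=
    exists_effectiveCycle_smul_wedge_wedgeFamily_eq_chainCycleClass_forall_mem_support Φ e hq k hk hp' hr hY hD τ
  refine ⟨R, hR0, hRs, hRpure, fun C hC hCdim ↦ ?_, hRcl⟩
  have hZan := isAnalyticSet_inter_iInter_translate Φ hY hD τ
  -- off the other components, `Z(τ)` is `C`
  obtain ⟨V, hVo, hCV, hZV⟩ := exists_isOpen_nonempty_inter_subset_of_isIrreducibleComponent Φ hZan hC
  have hZC : (Y ∩ ⋂ j, (fun x ↦ x + τ j) ⁻¹' D j) ∩ V = C ∩ V :=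
    Subset.antisymm (fun x hx ↦ ⟨hZV hx, hx.2⟩) fun x hx ↦ ⟨hC.subset hx.1, hx.2⟩
  -- so the points of `C ∩ V` are proper, hence on `|R|`
  have hCVR : C ∩ V ⊆ R.support := fun x hx ↦
    hmem x (hC.subset hx.1) (eventually_finrank_le_of_inter_eq_inter₁₉ Φ hVo hCdim hZC hx.2)
  -- the irreducible `C` then lies in `|R|`
  have hCR : C ⊆ R.support :=
    hC.isIrreducibleAnalyticSet.subset_of_isOpen_inter_subset R.isAnalyticSet_support hVo hCV hCVR
  exact isIrreducibleComponent_support_and_one_le_mult_of_subset Φ R hR0 hRpure hC.isIrreducibleAnalyticSet hCdim hCR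

omit [DecidableEq ι] [MeasurableSpace E] [BorelSpace E] in
/-- **The proper components of `Z(τ)` form a finite set** (as do all irreducible components of the closed
analytic `Z(τ)` in the compact `X`). [cite: Chirka1989, §5.4 Thm., p. 57] -/
theorem finite_setOf_isIrreducibleComponent_and_hasPureDim {k d q r : ℕ} {Y : Set (ComplexTorus Φ)}
    (hY : HasPureDim 𝓘(ℂ, E) Y d) {D : Fin k → Set (ComplexTorus Φ)} (hD : ∀ j, HasPureDim 𝓘(ℂ, E) (D j) q)
    (τ : Fin k → ComplexTorus Φ) :
    {C : Set (ComplexTorus Φ) | IsIrreducibleComponent 𝓘(ℂ, E) (Y ∩ ⋂ j, (fun x ↦ x + τ j) ⁻¹' D j) C ∧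
      HasPureDim 𝓘(ℂ, E) C r}.Finite :=
  (finite_isIrreducibleComponent Φ (isAnalyticSet_inter_iInter_translate Φ hY hD τ)).subset fun _ h ↦ h.1

/-! ### §3 Refined Bézout for the proper components amid excess components -/

/-- **`Σ_{C proper} Re ⟨θ, [C]⟩ ≤ Re ⟨θ, sign(e)^k · [Y] ∧ [D₀] ∧ ⋯ ∧ [D_{k−1}]⟩`** for every finite set `S`
of proper components of an ARBITRARY `Z(τ) = Y ∩ ⋂_j (D_j − τ_j)` and every `2(r+1)`-form `θ` pairing
non-negatively with the `(r+1)`-dimensional subvarieties: the right-hand side is `Σ_W m_W Re ⟨θ, [W]⟩` over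
the components `W` of the effective Fulton cycle `R` (§2), the proper components are among them with
`m_C ≥ 1`, and all terms are `≥ 0`. [cite: Fulton1998, §7.1 Prop. 7.1 (a), §8.4 Example 8.4.6 and §12.2 Cor. 12.2 (a)]
[cite: VoisinHodgeI2002, §11.1.2 Rem. 11.19] -/
theorem sum_re_poincarePairing_setCycleClass_le_of_proper_components {q : ℕ} (hq : 2 * q + 2 * 1 = n)
    (k : ℕ) {d p p' r : ℕ} (hk : 2 * d + 2 * p = n) (hp' : p + k = p') (hr : r + 1 + k = d)
    {Y : Set (ComplexTorus Φ)} (hY : HasPureDim 𝓘(ℂ, E) Y d)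
    {D : Fin k → Set (ComplexTorus Φ)} (hD : ∀ j, HasPureDim 𝓘(ℂ, E) (D j) q) (τ : Fin k → ComplexTorus Φ)
    (S : Finset (Set (ComplexTorus Φ)))
    (hS : ∀ C ∈ S, IsIrreducibleComponent 𝓘(ℂ, E) (Y ∩ ⋂ j, (fun x ↦ x + τ j) ⁻¹' D j) C ∧
      HasPureDim 𝓘(ℂ, E) C (r + 1))
    (θ : E [⋀^Fin (2 * (r + 1))]→L[ℝ] ℂ)
    (hθ : ∀ (W : Set (ComplexTorus Φ)), HasPureDim 𝓘(ℂ, E) W (r + 1) →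
      0 ≤ (poincarePairing Φ e (by omega : 2 * (r + 1) + 2 * p' = n) θ
        (setCycleClass Φ e (by omega : 2 * (r + 1) + 2 * p' = n) W)).re) :
    ∑ C ∈ S, (poincarePairing Φ e (by omega : 2 * (r + 1) + 2 * p' = n) θ
        (setCycleClass Φ e (by omega : 2 * (r + 1) + 2 * p' = n) C)).re ≤
      (poincarePairing Φ e (by omega : 2 * (r + 1) + 2 * p' = n) θ
        ((orientationSign Φ e : ℂ) ^ k •
          ((analyticCycleClass Φ e hk hY).wedge
              (wedgeFamily k fun j ↦ analyticCycleClass Φ e hq (hD j))).domDomCongr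
            (finCongr (by omega : 2 * p + 2 * k = 2 * p')))).re := by
  classical
  have h2 : 2 * (r + 1) + 2 * p' = n := by omega
  obtain ⟨R, hR0, -, -, hprop, hRcl⟩ :=
    exists_effectiveCycle_smul_wedge_wedgeFamily_eq_chainCycleClass_forall_one_le_mult Φ e hq k hk hp' hr hY hD τ
  rw [hRcl, poincarePairing_chainCycleClass, Complex.re_sum]
  have key : ∀ (m : ℤ) (z : ℂ), ((m : ℂ) * z).re = (m : ℝ) * z.re := fun m z ↦ by
    rw [← Complex.ofReal_intCast, Complex.re_ofReal_mul]
  -- the proper components are components of `R`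
  have hSsub : S ⊆ R.finite_components_of_compactSpace.toFinset := fun C hC ↦ by
    rw [Set.Finite.mem_toFinset, HolomorphicChain.mem_components_iff]
    have h1 := (hprop C (hS C hC).1 (hS C hC).2).2
    omega
  have hθ' : ∀ W ∈ R.finite_components_of_compactSpace.toFinset,
      0 ≤ (poincarePairing Φ e h2 θ (setCycleClass Φ e h2 W)).re := fun W hW ↦
    hθ W (R.hasPureDim_of_mult_ne_zero (R.finite_components_of_compactSpace.mem_toFinset.1 hW))
  calc ∑ C ∈ S, (poincarePairing Φ e h2 θ (setCycleClass Φ e h2 C)).re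
      ≤ ∑ C ∈ S, ((R.mult C : ℂ) * poincarePairing Φ e h2 θ (setCycleClass Φ e h2 C)).re := by
        refine Finset.sum_le_sum fun C hC ↦ ?_
        rw [key]
        have h1 : (1 : ℝ) ≤ ((R.mult C : ℤ) : ℝ) := by exact_mod_cast (hprop C (hS C hC).1 (hS C hC).2).2
        have h0 := hθ' C (hSsub hC)
        nlinarith
    _ ≤ ∑ W ∈ R.finite_components_of_compactSpace.toFinset,
          ((R.mult W : ℂ) * poincarePairing Φ e h2 θ (setCycleClass Φ e h2 W)).re :=
        Finset.sum_le_sum_of_subset_of_nonneg hSsub fun W hW _ ↦ by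
          rw [key]
          exact mul_nonneg (by exact_mod_cast hR0 W) (hθ' W hW)

/-- **One proper component: `Re ⟨θ, [C]⟩ ≤ Re ⟨θ, sign(e)^k · [Y] ∧ [D₀] ∧ ⋯ ∧ [D_{k−1}]⟩`** for `θ` pairing
non-negatively with the `(r+1)`-dimensional subvarieties. [cite: Fulton1998, §7.1 Prop. 7.1 (a) and §12.2 Cor. 12.2 (a)]
[cite: VoisinHodgeI2002, §11.1.2 Rem. 11.19] -/
theorem re_poincarePairing_analyticCycleClass_le_of_isIrreducibleComponent {q : ℕ} (hq : 2 * q + 2 * 1 = n)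
    (k : ℕ) {d p p' r : ℕ} (hk : 2 * d + 2 * p = n) (hp' : p + k = p') (hr : r + 1 + k = d)
    {Y : Set (ComplexTorus Φ)} (hY : HasPureDim 𝓘(ℂ, E) Y d)
    {D : Fin k → Set (ComplexTorus Φ)} (hD : ∀ j, HasPureDim 𝓘(ℂ, E) (D j) q) (τ : Fin k → ComplexTorus Φ)
    {C : Set (ComplexTorus Φ)} (hC : IsIrreducibleComponent 𝓘(ℂ, E) (Y ∩ ⋂ j, (fun x ↦ x + τ j) ⁻¹' D j) C)
    (hCdim : HasPureDim 𝓘(ℂ, E) C (r + 1)) (θ : E [⋀^Fin (2 * (r + 1))]→L[ℝ] ℂ)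
    (hθ : ∀ (W : Set (ComplexTorus Φ)), HasPureDim 𝓘(ℂ, E) W (r + 1) →
      0 ≤ (poincarePairing Φ e (by omega : 2 * (r + 1) + 2 * p' = n) θ
        (setCycleClass Φ e (by omega : 2 * (r + 1) + 2 * p' = n) W)).re) :
    (poincarePairing Φ e (by omega : 2 * (r + 1) + 2 * p' = n) θ
        (analyticCycleClass Φ e (by omega : 2 * (r + 1) + 2 * p' = n) hCdim)).re ≤
      (poincarePairing Φ e (by omega : 2 * (r + 1) + 2 * p' = n) θ
        ((orientationSign Φ e : ℂ) ^ k •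
          ((analyticCycleClass Φ e hk hY).wedge
              (wedgeFamily k fun j ↦ analyticCycleClass Φ e hq (hD j))).domDomCongr
            (finCongr (by omega : 2 * p + 2 * k = 2 * p')))).re := by
  have h := sum_re_poincarePairing_setCycleClass_le_of_proper_components Φ e hq k hk hp' hr hY hD τ {C}
    (fun C' hC' ↦ by rw [Finset.mem_singleton.1 hC']; exact ⟨hC, hCdim⟩) θ hθ
  rwa [Finset.sum_singleton, setCycleClass_of_hasPureDim Φ e _ hCdim] at h

/-- **Polarised: `Σ_{C proper} (L^{r+1} · C) ≤ (L^{r+1} · Y · D₀ ⋯ D_{k−1})`** for every finite set `S` of proper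
components of an arbitrary `Z(τ)` — with `θ = c₁(L)^{∧(r+1)}`, `c₁(L) = ofRealForm(−η)` for a Riemann form `η`
(`(L^{r+1} · W) > 0` on subvarieties). This is Fulton's refined Bézout "`Σ_i deg Z_i ≤ ∏_j deg V_j`"
(Example 8.4.6) for the proper `Z_i`, on a polarised complex torus.
[cite: Fulton1998, §8.4 Example 8.4.6 and §12.2 Cor. 12.2 (a), Example 12.2.1 (a)]
[cite: deJong1993AmpleLineBundles, Ch. VII §4 Thm. 4.3.1] -/
theorem IsRiemannForm.sum_re_poincarePairing_wedgePow_setCycleClass_le_of_proper_components {q : ℕ}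
    (hq : 2 * q + 2 * 1 = n) (k : ℕ) {d p p' r : ℕ} (hk : 2 * d + 2 * p = n) (hp' : p + k = p')
    (hr : r + 1 + k = d) {Y : Set (ComplexTorus Φ)} (hY : HasPureDim 𝓘(ℂ, E) Y d)
    {D : Fin k → Set (ComplexTorus Φ)} (hD : ∀ j, HasPureDim 𝓘(ℂ, E) (D j) q) (τ : Fin k → ComplexTorus Φ)
    (S : Finset (Set (ComplexTorus Φ)))
    (hS : ∀ C ∈ S, IsIrreducibleComponent 𝓘(ℂ, E) (Y ∩ ⋂ j, (fun x ↦ x + τ j) ⁻¹' D j) C ∧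
      HasPureDim 𝓘(ℂ, E) C (r + 1))
    {η : E [⋀^Fin 2]→L[ℝ] ℝ} (hη : IsRiemannForm Φ η) :
    ∑ C ∈ S, (poincarePairing Φ e (by omega : 2 * (r + 1) + 2 * p' = n) (wedgePow (ofRealForm (-η)) (r + 1))
        (setCycleClass Φ e (by omega : 2 * (r + 1) + 2 * p' = n) C)).re ≤
      (poincarePairing Φ e (by omega : 2 * (r + 1) + 2 * p' = n) (wedgePow (ofRealForm (-η)) (r + 1))
        ((orientationSign Φ e : ℂ) ^ k •
          ((analyticCycleClass Φ e hk hY).wedge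
              (wedgeFamily k fun j ↦ analyticCycleClass Φ e hq (hD j))).domDomCongr
            (finCongr (by omega : 2 * p + 2 * k = 2 * p')))).re := by
  refine sum_re_poincarePairing_setCycleClass_le_of_proper_components Φ e hq k hk hp' hr hY hD τ S hS _
    fun W hW ↦ ?_
  rw [setCycleClass_of_hasPureDim Φ e _ hW]
  exact (hη.re_poincarePairing_wedgePow_analyticCycleClass_pos Φ e _ hW).le

/-- **Polarised, one proper component: `1 ≤ (L^{r+1} · C) ≤ (L^{r+1} · Y · D₀ ⋯ D_{k−1})`.** In particular an
iterated intersection with a proper component has a positive intersection number (cf. file 18 §2).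
[cite: Fulton1998, §7.1 Prop. 7.1 (a) and §12.2 Cor. 12.2 (a), (b)] [cite: deJong1993AmpleLineBundles, Ch. VII §4 Remarks 4.3 (a) and Thm. 4.3.1] -/
theorem IsRiemannForm.one_le_re_poincarePairing_wedgePow_analyticCycleClass_and_le_of_isIrreducibleComponent
    {q : ℕ} (hq : 2 * q + 2 * 1 = n) (k : ℕ) {d p p' r : ℕ} (hk : 2 * d + 2 * p = n) (hp' : p + k = p')
    (hr : r + 1 + k = d) {Y : Set (ComplexTorus Φ)} (hY : HasPureDim 𝓘(ℂ, E) Y d)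
    {D : Fin k → Set (ComplexTorus Φ)} (hD : ∀ j, HasPureDim 𝓘(ℂ, E) (D j) q) (τ : Fin k → ComplexTorus Φ)
    {C : Set (ComplexTorus Φ)} (hC : IsIrreducibleComponent 𝓘(ℂ, E) (Y ∩ ⋂ j, (fun x ↦ x + τ j) ⁻¹' D j) C)
    (hCdim : HasPureDim 𝓘(ℂ, E) C (r + 1)) {η : E [⋀^Fin 2]→L[ℝ] ℝ} (hη : IsRiemannForm Φ η) :
    1 ≤ (poincarePairing Φ e (by omega : 2 * (r + 1) + 2 * p' = n) (wedgePow (ofRealForm (-η)) (r + 1))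
        (analyticCycleClass Φ e (by omega : 2 * (r + 1) + 2 * p' = n) hCdim)).re ∧
      (poincarePairing Φ e (by omega : 2 * (r + 1) + 2 * p' = n) (wedgePow (ofRealForm (-η)) (r + 1))
          (analyticCycleClass Φ e (by omega : 2 * (r + 1) + 2 * p' = n) hCdim)).re ≤
        (poincarePairing Φ e (by omega : 2 * (r + 1) + 2 * p' = n) (wedgePow (ofRealForm (-η)) (r + 1))
          ((orientationSign Φ e : ℂ) ^ k •
            ((analyticCycleClass Φ e hk hY).wedge
                (wedgeFamily k fun j ↦ analyticCycleClass Φ e hq (hD j))).domDomCongr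
              (finCongr (by omega : 2 * p + 2 * k = 2 * p')))).re := by
  refine ⟨?_, re_poincarePairing_analyticCycleClass_le_of_isIrreducibleComponent Φ e hq k hk hp' hr hY hD τ hC
    hCdim _ fun W hW ↦ ?_⟩
  · rw [poincarePairing_analyticCycleClass]
    exact hη.one_le_re_analyticCyclePeriod_wedgePow Φ hCdim
  · rw [setCycleClass_of_hasPureDim Φ e _ hW]
    exact (hη.re_poincarePairing_wedgePow_analyticCycleClass_pos Φ e _ hW).le

/-- **BÉZOUT AMID EXCESS COMPONENTS: `#{proper components of Z(τ)} ≤ (L^{r+1} · Y · D₀ ⋯ D_{k−1})`** for an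
ARBITRARY `τ` on a polarised complex torus (`η` a Riemann form, `c₁(L) = ofRealForm(−η)`): every proper
component contributes `m_C · (L^{r+1} · C) ≥ 1` to the degree of the effective Fulton cycle, the excess
components contribute `≥ 0`. File 9 §2 is the special case of a proper `Z(τ)`.
[cite: Fulton1998, §8.4 Example 8.4.6 and §12.2 Cor. 12.2 (a), Example 12.2.1 (a)]
[cite: deJong1993AmpleLineBundles, Ch. VII §4 Remarks 4.3 (a), (c) and Thm. 4.3.1] -/
theorem IsRiemannForm.ncard_properComponent_le_re_poincarePairing {q : ℕ}
    (hq : 2 * q + 2 * 1 = n) (k : ℕ) {d p p' r : ℕ} (hk : 2 * d + 2 * p = n) (hp' : p + k = p')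
    (hr : r + 1 + k = d) {Y : Set (ComplexTorus Φ)} (hY : HasPureDim 𝓘(ℂ, E) Y d)
    {D : Fin k → Set (ComplexTorus Φ)} (hD : ∀ j, HasPureDim 𝓘(ℂ, E) (D j) q) (τ : Fin k → ComplexTorus Φ)
    {η : E [⋀^Fin 2]→L[ℝ] ℝ} (hη : IsRiemannForm Φ η) :
    (({C : Set (ComplexTorus Φ) |
        IsIrreducibleComponent 𝓘(ℂ, E) (Y ∩ ⋂ j, (fun x ↦ x + τ j) ⁻¹' D j) C ∧
          HasPureDim 𝓘(ℂ, E) C (r + 1)}.ncard : ℕ) : ℝ) ≤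
      (poincarePairing Φ e (by omega : 2 * (r + 1) + 2 * p' = n) (wedgePow (ofRealForm (-η)) (r + 1))
        ((orientationSign Φ e : ℂ) ^ k •
          ((analyticCycleClass Φ e hk hY).wedge
              (wedgeFamily k fun j ↦ analyticCycleClass Φ e hq (hD j))).domDomCongr
            (finCongr (by omega : 2 * p + 2 * k = 2 * p')))).re := by
  have hfin := finite_setOf_isIrreducibleComponent_and_hasPureDim Φ (r := r + 1) hY hD τ
  rw [Set.ncard_eq_toFinset_card _ hfin]
  have hS : ∀ C ∈ hfin.toFinset, IsIrreducibleComponent 𝓘(ℂ, E) (Y ∩ ⋂ j, (fun x ↦ x + τ j) ⁻¹' D j) C ∧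
      HasPureDim 𝓘(ℂ, E) C (r + 1) := fun C hC ↦ hfin.mem_toFinset.1 hC
  refine le_trans ?_
    (hη.sum_re_poincarePairing_wedgePow_setCycleClass_le_of_proper_components Φ e hq k hk hp' hr hY hD τ _ hS)
  rw [Finset.card_eq_sum_ones, Nat.cast_sum, Nat.cast_one]
  refine Finset.sum_le_sum fun C hC ↦ ?_
  rw [poincarePairing_setCycleClass Φ e _ (hS C hC).2]
  exact hη.one_le_re_analyticCyclePeriod_wedgePow Φ (hS C hC).2

/-- **If `(L^{r+1} · Y · D₀ ⋯ D_{k−1}) = m ∈ ℕ`, every `Z(τ)` has at most `m` proper components.**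
[cite: Fulton1998, §8.4 Example 8.4.6 and §12.2 Cor. 12.2 (a)] [cite: deJong1993AmpleLineBundles, Ch. VII §4 Thm. 4.3.1] -/
theorem IsRiemannForm.ncard_properComponent_le_of_poincarePairing_eq_natCast {q : ℕ}
    (hq : 2 * q + 2 * 1 = n) (k : ℕ) {d p p' r : ℕ} (hk : 2 * d + 2 * p = n) (hp' : p + k = p')
    (hr : r + 1 + k = d) {Y : Set (ComplexTorus Φ)} (hY : HasPureDim 𝓘(ℂ, E) Y d)
    {D : Fin k → Set (ComplexTorus Φ)} (hD : ∀ j, HasPureDim 𝓘(ℂ, E) (D j) q) (τ : Fin k → ComplexTorus Φ)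
    {η : E [⋀^Fin 2]→L[ℝ] ℝ} (hη : IsRiemannForm Φ η) {m : ℕ}
    (hm : poincarePairing Φ e (by omega : 2 * (r + 1) + 2 * p' = n) (wedgePow (ofRealForm (-η)) (r + 1))
        ((orientationSign Φ e : ℂ) ^ k •
          ((analyticCycleClass Φ e hk hY).wedge
              (wedgeFamily k fun j ↦ analyticCycleClass Φ e hq (hD j))).domDomCongr
            (finCongr (by omega : 2 * p + 2 * k = 2 * p'))) = m) :
    {C : Set (ComplexTorus Φ) |
      IsIrreducibleComponent 𝓘(ℂ, E) (Y ∩ ⋂ j, (fun x ↦ x + τ j) ⁻¹' D j) C ∧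
        HasPureDim 𝓘(ℂ, E) C (r + 1)}.ncard ≤ m := by
  have h := hη.ncard_properComponent_le_re_poincarePairing Φ e hq k hk hp' hr hY hD τ
  rw [hm, Complex.natCast_re] at h
  exact_mod_cast h

/-- **Universal form: there is `m ∈ ℕ`, `m = (L^{r+1} · Y · D₀ ⋯ D_{k−1})`, bounding the number of proper
components of `Y ∩ ⋂_j (D_j − τ_j)` for EVERY `τ ∈ X^k`** (file 16: the intersection number is a natural
number, independent of `τ`). [cite: Fulton1998, §8.4 Example 8.4.6, §10.2 Cor. 10.2.1 and §12.2 Cor. 12.2 (a)]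
[cite: deJong1993AmpleLineBundles, Ch. VII §4 Thm. 4.3.1] -/
theorem IsRiemannForm.exists_nat_poincarePairing_eq_and_forall_ncard_properComponent_le {q : ℕ}
    (hq : 2 * q + 2 * 1 = n) (k : ℕ) {d p p' r : ℕ} (hk : 2 * d + 2 * p = n) (hp' : p + k = p')
    (hr : r + 1 + k = d) {Y : Set (ComplexTorus Φ)} (hY : HasPureDim 𝓘(ℂ, E) Y d)
    {D : Fin k → Set (ComplexTorus Φ)} (hD : ∀ j, HasPureDim 𝓘(ℂ, E) (D j) q)
    {η : E [⋀^Fin 2]→L[ℝ] ℝ} (hη : IsRiemannForm Φ η) :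
    ∃ m : ℕ, poincarePairing Φ e (by omega : 2 * (r + 1) + 2 * p' = n) (wedgePow (ofRealForm (-η)) (r + 1))
        ((orientationSign Φ e : ℂ) ^ k •
          ((analyticCycleClass Φ e hk hY).wedge
              (wedgeFamily k fun j ↦ analyticCycleClass Φ e hq (hD j))).domDomCongr
            (finCongr (by omega : 2 * p + 2 * k = 2 * p'))) = m ∧
      ∀ τ : Fin k → ComplexTorus Φ,
        {C : Set (ComplexTorus Φ) |
          IsIrreducibleComponent 𝓘(ℂ, E) (Y ∩ ⋂ j, (fun x ↦ x + τ j) ⁻¹' D j) C ∧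
            HasPureDim 𝓘(ℂ, E) C (r + 1)}.ncard ≤ m := by
  obtain ⟨m, hm⟩ := hη.exists_nat_poincarePairing_wedgePow_smul_wedge_wedgeFamily_eq Φ e hq k hk hp'
    (r := r + 1) hr hY hD
  exact ⟨m, hm, fun τ ↦ hη.ncard_properComponent_le_of_poincarePairing_eq_natCast Φ e hq k hk hp' hr hY hD τ hm⟩

end ComplexTorus

end Literature.Geometry.Kaehler

end
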